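/-
Copyright (c) 2026 the pub-hodgecm-mathlib formalisation cell (harness21).  Prover seat hodgecm-mathlib-K2Liu-p12 (g0): Track B «K2-LIT»,
#184♮ = hLiu418 = stmt-HodgeConjecture-24832; Road Φ of socket #41, organ Φ4 «unramified local coefficient» (LEAD F0P6-plan (g13) ruling «M-157k»), ASSEMBLY.
-/
import Summits.HodgeConjecture.HodgeConjecture.Theorems.K2LiuGoodPlaceWhittakerFarShells  -- ★ U1: far shells, explicit supply radius
import Summits.HodgeConjecture.HodgeConjecture.Theorems.K2LiuGoodPlaceLeviSupply          -- ★ U1′: the supply in `K_v` at radius `1`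
import Summits.HodgeConjecture.HodgeConjecture.Theorems.K2LiuSiegelWeylUnipotentContent   -- ★ U2: the spherical sup bound
import Summits.HodgeConjecture.HodgeConjecture.Theorems.K2LiuBadPlaceWhittakerHeads       -- ★ F4b-2: ball formula ∕ bound (carrier-free)
import Summits.HodgeConjecture.HodgeConjecture.Theorems.K2LiuBadPlaceWhittakerEntire      -- ★ the tie: `whittaker_integral_eq_setIntegral_ball`
import Summits.HodgeConjecture.HodgeConjecture.Theorems.K2LiuSkewLatticeShells           -- ★ F3b (K2Liu-p08): balls, Levi preservation, pull-back regularity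
import HarnessLib

/-!
# Crux `HLiu418`, Road Φ of socket #41, organ Φ4 — ASSEMBLY: THE UNRAMIFIED WHITTAKER COEFFICIENT IS ONE BALL INTEGRAL OF ABSOLUTE RADIUS, BOUNDED BY ITS VOLUME

Cell `hodgecm-mathlib`, crux item hLiu418 = `stmt-HodgeConjecture-24832`, route of record `HCCMUnconditional`; squad K2 ∕ K2Liu, road `K2_Liu`,
socket #41 `sig_K2LiuSiegelEisensteinContinuation`, Road Φ, organ Φ4 = «(R-bound) + the one exact value» (ruling M-157k; census
`K2/K2Liu-p12/g0/CENSUS-PHI4-UnramifiedLocalCoefficient.K2Liu-p12-g0.md` §1).  THEOREMS ONLY (no `def`, no `instance`, no `notation`, no named-fact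
hypothesis, no `sorry`); lane `--supports stmt-HodgeConjecture-24832` (count-neutral helper; closes no socket by itself).

THE (R-bound) FACE, LOCAL PART.  Frame ★ D10 `H(F_v)` at a GOOD place `v` of `F`: `|2|_w = 1` for all `w ∣ v`, `T = T₀ ⊗ 1` and `T⁻¹` integral, `χ_w`
unitary and unramified; `φ_s` the SPHERICAL section of `I_v(s, χ_v)` (★ `IsSphericalSection`, any family in `s`); `ψ_v` of conductor exponent `d`, `ε`
anti-invariant integral with `v(2ε) ≥ v(ϖ)^{c_ε}`, `v(2) ≥ v(ϖ)^{c₂}` (all `0` off `2δ` and the conductor of `ψ`); `β` a `T`-skew Fourier index with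
`β ∈ ball(−b)`, `β⁻¹ ∈ ball(−b′)`.  With the ABSOLUTE threshold
  **`K(β) := 3 + |d| + 2|c_ε| + 2|c₂| + 4b + 2b′`**
(i) `goodPlace_farShell_eq_zero` — the shells `B(−k) ∖ B(−k+1)`, `k ≥ K(β) + 1`, contribute `0` to `W_β(φ_s) = ∫ φ_s(w_Δ n(t)) ψ_v(−τ tr(β t)) dt` (★ U1 fed by ★ U1′:
`jS = jI = 1`, `b_T = 0`);  (ii) `goodPlace_whittaker_setIntegral_ball_eq` — `∫_{B(−k)} = ∫_{B(−K(β))}` for every `k ≥ K(β)` and EVERY `s` (so the unramified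
local Whittaker coefficient IS the ball integral of radius `K(β)`, entire in `s` by ★ `differentiable_whittaker`);  (iii) `goodPlace_whittaker_norm_le` — for
`Re s + n/2 ≥ 0`:  **`‖∫_{B(−K(β))} φ_s(w_Δ n(t)) ψ_v(−τ tr(β t)) dμ‖ ≤ μ(B(−K(β)))`** (★ U2: `‖φ_s(w_Δ n(X))‖ ≤ 1`).  Since `b = 0` for `β` integral at `v`
and `b′ ≤ ord`-data of `det β` (adjugate), and `μ(B(−K)) ≤ q_v^{c(n)K} μ(B(0))` (ball-volume growth, file U3), this is the `v`-UNIFORM bound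
`|W°_{β,v}(s)| ≤ q_v^{c(1 + ord_v det β)} μ_v(B_v(0))` of the G2∕Φ9 majorant (census §1), with `W°_{β,v} = b_v(s)⁻¹ = (1 − q_v^{−(2s+1)})(1 − ε(ϖ_v)q_v^{−(2s+2)})`
for `β` `v`-unimodular being the separate exact-value file.

## References
* [Casselman1980] W. Casselman, Compositio Math. 40 (1980), §3.   * [KudlaRallis1994] S. Kudla, S. Rallis, Ann. of Math. 140 (1994), §2.
* [Shimura1997] G. Shimura, CBMS 93 (1997), §13, §18–§19.   * [HarrisKudlaSweet1996] M. Harris, S. Kudla, W. J. Sweet, J. AMS 9 (1996), §1, §6.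
-/

set_option autoImplicit false
-- the mandated namespace repeats the single-problem summit's segment (`HodgeConjecture.HodgeConjecture`)
set_option linter.dupNamespace false

noncomputable section

open scoped NNReal ENNReal Matrix Topology ValuativeRel
open NumberField IsDedekindDomain Matrix MeasureTheory Set Filter
open Literature.NumberTheory.Automorphic Literature.NumberTheory.Automorphic.UnitaryGroup
open Literature.NumberTheory.GelbartRogawski1991.AdaptedBlocks
open Literature.NumberTheory.GelbartRogawski1991.UnitaryDualPair.LocalSplitting
open Literature.NumberTheory.K2Lit.LocalSiegelDoubled
open Summit.HodgeConjecture.HodgeConjecture.Cruxes.HLiu418.K2LiuLocalRingValuationBalls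
open Summit.HodgeConjecture.HodgeConjecture.Cruxes.HLiu418.K2LiuGoodPlaceWhittakerFarShells
open Summit.HodgeConjecture.HodgeConjecture.Cruxes.HLiu418.K2LiuGoodPlaceLeviSupply
open Summit.HodgeConjecture.HodgeConjecture.Cruxes.HLiu418.K2LiuSiegelWeylUnipotentContent
open Summit.HodgeConjecture.HodgeConjecture.Cruxes.HLiu418.K2LiuBadPlaceWhittakerHeads
open Summit.HodgeConjecture.HodgeConjecture.Cruxes.HLiu418.K2LiuBadPlaceWhittakerEntire
open Summit.HodgeConjecture.HodgeConjecture.Cruxes.HLiu418.K2LiuSkewLatticeShells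

namespace Summit.HodgeConjecture.HodgeConjecture.Cruxes.HLiu418.K2LiuGoodPlaceWhittakerBound

variable (F : Type) [Field F] [NumberField F] (E : Type) [Field E] [NumberField E] [Algebra F E]
  [Algebra.IsQuadraticExtension F E] (c : E ≃ₐ[F] E)
  {δ : E} (hcδ : c δ = -δ) (hδ : δ ≠ 0) {dd : F} (hd : δ * δ = algebraMap F E dd)
  (v : HeightOneSpectrum (𝓞 F)) (n : ℕ) {T₀ : Matrix (Fin n) (Fin n) F} (hT₀ : T₀.IsSymm) (hT₀d : IsUnit T₀.det)
  {JD : Matrix (Fin (n + n)) (Fin (n + n)) E} (hJD : JD = (gramD F n T₀).map (algebraMap F E))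
  {π : v.adicCompletion F} (hπ : Valued.v π = WithZero.exp (-1 : ℤ))

include hcδ hδ hd hT₀ hT₀d hJD hπ in
/-- **(i) FAR SHELLS AT A GOOD PLACE, ABSOLUTE THRESHOLD.**  For the spherical family `φ_s` and a `T`-skew `β` with `β β⁻ = 1`, `β ∈ ball(−b)`, `β⁻ ∈ ball(−b′)`:
every shell `B(−k) ∖ B(−k+1)` with `k ≥ 4 + |d| + 2|c_ε| + 2|c₂| + 4b + 2b′` contributes `0` to `W_β(φ_s)`, for every `s` (★ U1 with the ★ U1′ supply:
`U = K_v`, `jS = jI = 1`, `b_T = 0`). [cite: Casselman1980, §3] [cite: KudlaRallis1994, §2] [cite: Shimura1997, §18] -/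
theorem goodPlace_farShell_eq_zero
    (S : AddSubgroup (Matrix (Fin n) (Fin n) (LocalRing E v)))
    (hS : ∀ t, t ∈ S ↔ (t.map (conjLocal E c v))ᵀ * gramS F E v n T₀ + gramS F E v n T₀ * t = 0)
    [MeasurableSpace S] [BorelSpace S] [LocallyCompactSpace S] (μ : Measure S) [μ.IsAddHaarMeasure] [μ.Regular]
    [MeasurableSpace (v.adicCompletion F)] [BorelSpace (v.adicCompletion F)] (μF : Measure (v.adicCompletion F)) [μF.IsAddHaarMeasure]
    -- the good place
    (h2v : ∀ w : PlacesOver E v, ValuativeRel.valuation (w.1.adicCompletion E) (2 : w.1.adicCompletion E) = 1)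
    (hTb : ∀ i j (w : PlacesOver E v), Valued.v (gramS F E v n T₀ i j w) ≤ Valued.v (toPlace v w π) ^ (0 : ℤ))
    (hTib : ∀ i j (w : PlacesOver E v), Valued.v ((gramS F E v n T₀)⁻¹ i j w) ≤ Valued.v (toPlace v w π) ^ (0 : ℤ))
    {χv : ∀ w : PlacesOver E v, (w.1.adicCompletion E)ˣ →* ℂˣ}
    (hχur : ∀ (w : PlacesOver E v) (x : (w.1.adicCompletion E)ˣ), Valued.v (x : w.1.adicCompletion E) = 1 → χv w x = 1)
    -- the spherical family
    {φ : ℂ → UnitaryGroup.localPi E c (n + n) JD v → ℂ} (hφ : ∀ s, IsSphericalSection F E c hcδ hδ hd v n hT₀ hJD χv s (φ s))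
    -- the additive character and the trace-type functional
    {ψ : AddChar (v.adicCompletion F) Circle} (hψ : Continuous ψ) {d : ℤ} (hdψ : ψ.HasConductorExp d)
    {τ : LocalRing E v → v.adicCompletion F} (hτ : ∀ r, toLocalRing E v (τ r) = r + conjLocal E c v r) (hτadd : ∀ r s, τ (r + s) = τ r + τ s)
    (hτs : ∀ (z : v.adicCompletion F) (r : LocalRing E v), τ (toLocalRing E v z * r) = z * τ r) (hτc : Continuous τ)
    -- the anti-invariant integral element and the constants
    {ε : LocalRing E v} (hεσ : conjLocal E c v ε = -ε) (hεint : ∀ w : PlacesOver E v, Valued.v (ε w) ≤ 1) {cε c₂ : ℤ}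
    (hε : ∀ w : PlacesOver E v, Valued.v (toPlace v w π) ^ cε ≤ Valued.v ((2 * ε) w))
    (h2 : ∀ w : PlacesOver E v, Valued.v (toPlace v w π) ^ c₂ ≤ Valued.v ((2 : LocalRing E v) w))
    -- the Fourier index
    {b b' : ℤ} {β βinv : Matrix (Fin n) (Fin n) (LocalRing E v)} (hb : 0 ≤ b) (hb' : 0 ≤ b')
    (hβskew : (β.map (conjLocal E c v))ᵀ * gramS F E v n T₀ + gramS F E v n T₀ * β = 0) (hββ : β * βinv = 1)
    (hβ : ∀ i j (w : PlacesOver E v), Valued.v (β i j w) ≤ Valued.v (toPlace v w π) ^ (-b))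
    (hβinv : ∀ i j (w : PlacesOver E v), Valued.v (βinv i j w) ≤ Valued.v (toPlace v w π) ^ (-b'))
    (s : ℂ) {k : ℤ} (hk : 4 + |d| + 2 * |cε| + 2 * |c₂| + 4 * b + 2 * b' ≤ k) :
    ∫ t in {t : S | ∀ i j (w : PlacesOver E v), Valued.v (t.1 i j w) ≤ Valued.v (toPlace v w π) ^ (-k)} \
        {t : S | ∀ i j (w : PlacesOver E v), Valued.v (t.1 i j w) ≤ Valued.v (toPlace v w π) ^ (-k + 1)},
      φ s (weylDelta F E c v n hJD * nElem F E c v n hJD t.1 ((hS t.1).1 t.2)) * ((ψ (-τ (Matrix.trace (β * t.1))) : Circle) : ℂ) ∂μ = 0 := by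
  -- regularity of the spherical family along the pull-back (★ F3b)
  have hfc : ∀ s, Continuous (φ s) := fun s =>
    continuous_of_rightInvariant (UnitaryGroup.isOpen_localInt E c (n + n) JD v) fun g k hk => (hφ s).apply_mul_of_mem_localInt hk g
  have hφm : ∀ s, Measurable fun t : S => φ s (weylDelta F E c v n hJD * nElem F E c v n hJD t.1 ((hS t.1).1 t.2)) := fun s =>
    measurable_pullback F E c v n hJD S hS (hfc s)
  have hφC : ∀ s (k : ℤ), ∃ C : ℝ, ∀ t : S, (∀ i j (w : PlacesOver E v), Valued.v (t.1 i j w) ≤ Valued.v (toPlace v w π) ^ (-k)) →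
      ‖φ s (weylDelta F E c v n hJD * nElem F E c v n hJD t.1 ((hS t.1).1 t.2))‖ ≤ C := fun s k =>
    exists_bound_pullback_of_isCompact F E c v n hJD S hS (hfc s) (isCompact_ball F E c v hπ n S hS (-k))
  -- the lattice facts (★ F3b)
  have hBm := fun a : ℤ => measurableSet_ball F E v hπ n S a
  have hBfin := fun a : ℤ => measure_ball_ne_top F E c v hπ n S hS μ a
  have hB0 := measure_ball_ne_zero F E c v hπ n S hS μ 0
  -- `T`, `T⁻¹ ∈ ball(−0)`
  have hTb' : ∀ i j (w : PlacesOver E v), Valued.v (gramS F E v n T₀ i j w) ≤ Valued.v (toPlace v w π) ^ (-(0 : ℤ)) := by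
    rw [neg_zero]; exact hTb
  have hTib' : ∀ i j (w : PlacesOver E v), Valued.v ((gramS F E v n T₀)⁻¹ i j w) ≤ Valued.v (toPlace v w π) ^ (-(0 : ℤ)) := by
    rw [neg_zero]; exact hTib
  -- ★ U1 with the ★ U1′ supply
  have h := setIntegral_farShell_eq_zero_of_supply F E c hcδ hδ hd v n hT₀ hT₀d hJD hπ S hS μ μF (χv := χv)
    (U := UnitaryGroup.localInt E c (n + n) JD v) (fun s => (hφ s).isLocalSiegelSection) (fun s g k hk => (hφ s).apply_mul_of_mem_localInt hk g)
    hφm hφC hψ hdψ hτ hτadd hτs hτc hεσ hεint hε h2 hTb' hTib' le_rfl (jS := 1) (jI := 1)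
    (fun u hu z hz => levi_supply_localInt F E c hcδ hδ hd v n hT₀ hT₀d hJD hπ h2v hTb hTib hχur u hu z hz)
    (fun u hu z hz => by
      have hu' : ∀ a b₁ (w : PlacesOver E v), Valued.v (u a b₁ w) ≤ Valued.v (toPlace v w π) ^ (0 : ℤ) := by
        intro a b₁ w; have h := hu a b₁ w; rwa [show -(2 * (0 : ℤ)) = 0 by norm_num] at h
      exact (inv_one_add_smul F E v n hπ hu' hz).2.1)
    hBm hBfin hB0 (fun L A D' A' D'' hL hL' hA hD' hA' hD'' a => preimage_ball_eq_of_integral F E v hπ n S L hL hL' hA hD' hA' hD'' a)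
    b b' β βinv hb hb' (by simpa using hb) hβskew hββ hβ hβinv k ?_ s
  · exact h
  · have : |(1 : ℤ)| = 1 := abs_one
    omega

include hcδ hδ hd hT₀ hT₀d hJD hπ in
/-- **(ii) THE UNRAMIFIED WHITTAKER COEFFICIENT IS ONE BALL INTEGRAL OF ABSOLUTE RADIUS**: with `K(β) = 3 + |d| + 2|c_ε| + 2|c₂| + 4b + 2b′`,
`∫_{B(−k)} φ_s(w_Δ n(t)) ψ_v(−τ tr(β t)) dμ = ∫_{B(−K(β))} (same)` for every `k ≥ K(β)` and EVERY `s`. [cite: Casselman1980, §3] [cite: Shimura1997, §18] -/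
theorem goodPlace_whittaker_setIntegral_ball_eq
    (S : AddSubgroup (Matrix (Fin n) (Fin n) (LocalRing E v)))
    (hS : ∀ t, t ∈ S ↔ (t.map (conjLocal E c v))ᵀ * gramS F E v n T₀ + gramS F E v n T₀ * t = 0)
    [MeasurableSpace S] [BorelSpace S] [LocallyCompactSpace S] (μ : Measure S) [μ.IsAddHaarMeasure] [μ.Regular]
    [MeasurableSpace (v.adicCompletion F)] [BorelSpace (v.adicCompletion F)] (μF : Measure (v.adicCompletion F)) [μF.IsAddHaarMeasure]
    (h2v : ∀ w : PlacesOver E v, ValuativeRel.valuation (w.1.adicCompletion E) (2 : w.1.adicCompletion E) = 1)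
    (hTb : ∀ i j (w : PlacesOver E v), Valued.v (gramS F E v n T₀ i j w) ≤ Valued.v (toPlace v w π) ^ (0 : ℤ))
    (hTib : ∀ i j (w : PlacesOver E v), Valued.v ((gramS F E v n T₀)⁻¹ i j w) ≤ Valued.v (toPlace v w π) ^ (0 : ℤ))
    {χv : ∀ w : PlacesOver E v, (w.1.adicCompletion E)ˣ →* ℂˣ}
    (hχur : ∀ (w : PlacesOver E v) (x : (w.1.adicCompletion E)ˣ), Valued.v (x : w.1.adicCompletion E) = 1 → χv w x = 1)
    {φ : ℂ → UnitaryGroup.localPi E c (n + n) JD v → ℂ} (hφ : ∀ s, IsSphericalSection F E c hcδ hδ hd v n hT₀ hJD χv s (φ s))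
    {ψ : AddChar (v.adicCompletion F) Circle} (hψ : Continuous ψ) {d : ℤ} (hdψ : ψ.HasConductorExp d)
    {τ : LocalRing E v → v.adicCompletion F} (hτ : ∀ r, toLocalRing E v (τ r) = r + conjLocal E c v r) (hτadd : ∀ r s, τ (r + s) = τ r + τ s)
    (hτs : ∀ (z : v.adicCompletion F) (r : LocalRing E v), τ (toLocalRing E v z * r) = z * τ r) (hτc : Continuous τ)
    {ε : LocalRing E v} (hεσ : conjLocal E c v ε = -ε) (hεint : ∀ w : PlacesOver E v, Valued.v (ε w) ≤ 1) {cε c₂ : ℤ}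
    (hε : ∀ w : PlacesOver E v, Valued.v (toPlace v w π) ^ cε ≤ Valued.v ((2 * ε) w))
    (h2 : ∀ w : PlacesOver E v, Valued.v (toPlace v w π) ^ c₂ ≤ Valued.v ((2 : LocalRing E v) w))
    {b b' : ℤ} {β βinv : Matrix (Fin n) (Fin n) (LocalRing E v)} (hb : 0 ≤ b) (hb' : 0 ≤ b')
    (hβskew : (β.map (conjLocal E c v))ᵀ * gramS F E v n T₀ + gramS F E v n T₀ * β = 0) (hββ : β * βinv = 1)
    (hβ : ∀ i j (w : PlacesOver E v), Valued.v (β i j w) ≤ Valued.v (toPlace v w π) ^ (-b))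
    (hβinv : ∀ i j (w : PlacesOver E v), Valued.v (βinv i j w) ≤ Valued.v (toPlace v w π) ^ (-b'))
    (s : ℂ) {k : ℤ} (hk : 3 + |d| + 2 * |cε| + 2 * |c₂| + 4 * b + 2 * b' ≤ k) :
    ∫ t in {t : S | ∀ i j (w : PlacesOver E v), Valued.v (t.1 i j w) ≤ Valued.v (toPlace v w π) ^ (-k)},
        φ s (weylDelta F E c v n hJD * nElem F E c v n hJD t.1 ((hS t.1).1 t.2)) * ((ψ (-τ (Matrix.trace (β * t.1))) : Circle) : ℂ) ∂μ =
      ∫ t in {t : S | ∀ i j (w : PlacesOver E v), Valued.v (t.1 i j w) ≤ Valued.v (toPlace v w π) ^ (-(3 + |d| + 2 * |cε| + 2 * |c₂| + 4 * b + 2 * b'))},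
        φ s (weylDelta F E c v n hJD * nElem F E c v n hJD t.1 ((hS t.1).1 t.2)) * ((ψ (-τ (Matrix.trace (β * t.1))) : Circle) : ℂ) ∂μ := by
  have hfc : ∀ s, Continuous (φ s) := fun s =>
    continuous_of_rightInvariant (UnitaryGroup.isOpen_localInt E c (n + n) JD v) fun g k hk => (hφ s).apply_mul_of_mem_localInt hk g
  have hχcont : Continuous fun t : S => ((ψ (-τ (Matrix.trace (β * t.1))) : Circle) : ℂ) :=
    continuous_subtype_val.comp (hψ.comp (hτc.comp (continuous_const.matrix_mul continuous_subtype_val).matrix_trace).neg)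
  have h := setIntegral_ball_eq_of_farShell μ
    (B := fun a : ℤ => {t : S | ∀ i j (w : PlacesOver E v), Valued.v (t.1 i j w) ≤ Valued.v (toPlace v w π) ^ a})
    (fun a => measurableSet_ball F E v hπ n S a) (fun _ _ haa' => ball_antitone F E v hπ n S haa') (fun a => measure_ball_ne_top F E c v hπ n S hS μ a)
    (φ := fun s (t : S) => φ s (weylDelta F E c v n hJD * nElem F E c v n hJD t.1 ((hS t.1).1 t.2)))
    (χ := fun t : S => ((ψ (-τ (Matrix.trace (β * t.1))) : Circle) : ℂ)) (fun s => measurable_pullback F E c v n hJD S hS (hfc s))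
    hχcont.measurable (fun t => by rw [Circle.norm_coe])
    (fun s a => by
      obtain ⟨C, hC⟩ := exists_bound_pullback_of_isCompact F E c v n hJD S hS (hfc s) (isCompact_ball F E c v hπ n S hS a)
      exact ⟨C, hC⟩)
    (K := 4 + |d| + 2 * |cε| + 2 * |c₂| + 4 * b + 2 * b')
    (fun s k hk => goodPlace_farShell_eq_zero F E c hcδ hδ hd v n hT₀ hT₀d hJD hπ S hS μ μF h2v hTb hTib hχur hφ hψ hdψ hτ hτadd hτs hτc hεσ hεint
      hε h2 hb hb' hβskew hββ hβ hβinv s hk) s (k := k) (by omega)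
  rw [show 4 + |d| + 2 * |cε| + 2 * |c₂| + 4 * b + 2 * b' - 1 = 3 + |d| + 2 * |cε| + 2 * |c₂| + 4 * b + 2 * b' by ring] at h
  exact h

include hcδ hδ hd hT₀ hT₀d hJD hπ in
/-- **(iii) THE VOLUME BOUND.**  At a good place (`|2|_w = 1`, `T₀`, `T₀⁻¹` integral), for the spherical family with `χ_v` unitary and `Re s + n/2 ≥ 0`, the
ball integral is bounded by the volume of the ball:  `‖∫_{B(−K)} φ_s(w_Δ n(t)) ψ_v(−τ tr(β t)) dμ‖ ≤ μ(B(−K))`, for EVERY `K` and EVERY skew `β` (★ U2: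
`‖φ_s(w_Δ n(X))‖ ≤ 1`).  With (ii) and the ball-volume growth this is `|W°_{β,v}(s)| ≤ q_v^{c(n)K(β)} μ(B(0))`. [cite: Shimura1997, §13, §18] [cite: KudlaRallis1994, §2] -/
theorem goodPlace_whittaker_norm_le
    (S : AddSubgroup (Matrix (Fin n) (Fin n) (LocalRing E v)))
    (hS : ∀ t, t ∈ S ↔ (t.map (conjLocal E c v))ᵀ * gramS F E v n T₀ + gramS F E v n T₀ * t = 0)
    [MeasurableSpace S] [BorelSpace S] (μ : Measure S) [μ.IsAddHaarMeasure]
    (h2v : ∀ w : PlacesOver E v, ValuativeRel.valuation (w.1.adicCompletion E) (2 : w.1.adicCompletion E) = 1)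
    (hT : ∀ (w : PlacesOver E v) (i j : Fin n),
      ValuativeRel.valuation (w.1.adicCompletion E) (algebraMap E (w.1.adicCompletion E) (algebraMap F E (T₀ i j))) ≤ 1)
    (hTinv : ∀ (w : PlacesOver E v) (i j : Fin n),
      ValuativeRel.valuation (w.1.adicCompletion E) (algebraMap E (w.1.adicCompletion E) (algebraMap F E (T₀⁻¹ i j))) ≤ 1)
    {χv : ∀ w : PlacesOver E v, (w.1.adicCompletion E)ˣ →* ℂˣ} (hχ1 : ∀ (w : PlacesOver E v) (x : (w.1.adicCompletion E)ˣ), ‖((χv w x : ℂˣ) : ℂ)‖ = 1)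
    {s : ℂ} (hs : 0 ≤ s.re + (n : ℝ) / 2) {φs : UnitaryGroup.localPi E c (n + n) JD v → ℂ}
    (hφ : IsSphericalSection F E c hcδ hδ hd v n hT₀ hJD χv s φs)
    {ψ : AddChar (v.adicCompletion F) Circle} (τ : LocalRing E v → v.adicCompletion F) (β : Matrix (Fin n) (Fin n) (LocalRing E v)) (K : ℤ) :
    ‖∫ t in {t : S | ∀ i j (w : PlacesOver E v), Valued.v (t.1 i j w) ≤ Valued.v (toPlace v w π) ^ (-K)},
        φs (weylDelta F E c v n hJD * nElem F E c v n hJD t.1 ((hS t.1).1 t.2)) * ((ψ (-τ (Matrix.trace (β * t.1))) : Circle) : ℂ) ∂μ‖ ≤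
      μ.real {t : S | ∀ i j (w : PlacesOver E v), Valued.v (t.1 i j w) ≤ Valued.v (toPlace v w π) ^ (-K)} := by
  have h := norm_setIntegral_ball_le μ (measure_ball_ne_top F E c v hπ n S hS μ (-K))
    (φ := fun t : S => φs (weylDelta F E c v n hJD * nElem F E c v n hJD t.1 ((hS t.1).1 t.2)))
    (χ := fun t : S => ((ψ (-τ (Matrix.trace (β * t.1))) : Circle) : ℂ)) (C := 1)
    (fun t _ => norm_apply_weylDelta_mul_nElem_le_one F E c hcδ hδ hd v n hT₀ hT₀d hJD h2v hT hTinv hχ1 hs hφ t.1 ((hS t.1).1 t.2))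
    (fun t _ => by rw [Circle.norm_coe])
  rwa [one_mul] at h

end Summit.HodgeConjecture.HodgeConjecture.Cruxes.HLiu418.K2LiuGoodPlaceWhittakerBound

end
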